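import Summits.BirchSwinnertonDyer.Rank1Residual.GaloisImage.KolyvaginDerivativeUnramifiedTate
import HarnessLib

/-!
# Cocycles of an unramified representation vanish on the inertia INSIDE a ramified level
# (`H¹(F(rq)_𝔔, T_p E)` is unramified at `𝔔 ∣ q`) — item (3) of THEOREM C of row T-DER
# (cell `b2b-bsdres`, team n1011, seat p11 GEN 9, OWNERS row T-DER = skel/T-DER.md STATUS v8 (v8-2))

HONEST FRAMING (cell `b2b-bsdres`, run/shared/lean/b2b/bsd-rank1-residual/, verbatim in every
file): the goal of the cell is to DELETE the COMBINATION-SHAPED residual classes of the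
Birch–Swinnerton-Dyer formula for ALL analytic-rank `≤ 1` elliptic curves over `ℚ` — "full BSD
formula for every rank `≤ 1` curve in class `C`" assembled STRICTLY from published theorems — so
that the rank-`≤ 1` remainder becomes exactly the CONSTRUCTION-SHAPED classes, which are TYPED
(missing-input `Prop`s), NOT attempted. This is not "finishing BSD". Team n1011: research route on
the CONSTRUCTION-SHAPED class X4 / §I N11 (route-1 PORT, (P-DER)); TOOL theorems of local Galois
theory and continuous group cohomology (no definition, no named fact, no `sorry`); curve-free
until §3.

## What

File F6 (`KolyvaginDerivativeInertiaLocal`) proves: a continuous crossed homomorphism `φ` on an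
open subgroup `U` CONTAINING the inertia group at `v` (`U` unramified at `v`), with values in a
representation unramified at `v`, `v`-adically separated and with `ρ(Fr)^m − q_v^m` injective,
vanishes on every `I_𝔓`, `𝔓 ∣ v`.  THEOREM C evaluates `T`-valued cocycles on the levels
`Gal(K̄/F(rq))`, which are RAMIFIED at `q`: there the same mechanism shows that `φ` vanishes on
`I_𝔓 ∩ U` (Perrin-Riou, Ann. Inst. Fourier 48 (1998), Prop. 3.1.6, hypothesis "la restriction de
`[x]` à `H₀` appartient à `H¹_{nr}(H₀, T)`"; for `T_p E` this is automatic: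
`H¹(F(rq)_𝔔, T_p E) = H¹_{ur}` since `Hom(I, T_p E)^{Frob} = 0` by Weil — Rubin, PCMS 18, §3.1 p. 30).
This file re-runs F6 with the membership `σ ∈ U` carried per element instead of `I ≤ U`:
* §1 (local) `apply_eq_zero_of_mem_absWildInertia_of_mem`, `apply_eq_zero_of_mem_absInertia_of_mem`;
* §2 (number field) `apply_eq_zero_of_mem_inertia_adicCompletionPrime_of_mem`,
  `apply_eq_zero_of_mem_inertia_of_mem` (every `𝔓 ∣ v`, `U` normal);
* §3 (`T_p E`, good `v ∤ p`) `apply_eq_zero_of_mem_inertia_of_mem_tate` — the binders `hurI`,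
  `hurI'`, `hkill`, `hyN` of files C0d / G2 for Kato-type Euler systems.

References: B. Perrin-Riou, Ann. Inst. Fourier 48 (1998), §3.1.4–3.1.6; K. Rubin, *Euler Systems*
(2000), Lemma 1.3.5 (ii), Lemma 4.7.3; K. Rubin, PCMS 18 (2011), Prop. 1.4.13 (2), §3.1; J.-P. Serre,
*Local Fields* (1979), IV §2; J.-P. Serre, Invent. Math. 15 (1972), §1.8.
-/

noncomputable section

open Field IsDedekindDomain
open scoped NumberField Pointwise ValuativeRel
open Literature.NumberTheory.GaloisRepresentations
open Literature.NumberTheory.GaloisRepresentations.IsNonarchimedeanLocalField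
open Literature.NumberTheory.EllipticCurves (subgroupConj subgroupConj_apply_coe)

universe u v

namespace Summit.BirchSwinnertonDyer.Rank1Residual.GaloisImage

namespace Derivative

namespace Inertia

/-! ### §1 Over a non-archimedean local field -/

section Local

variable {F : Type u} [Field F] [ValuativeRel F] [TopologicalSpace F] [IsNonarchimedeanLocalField F]
variable {R : Type v} [Ring R] [TopologicalSpace R]
variable (X : TopRep.{u} R (absoluteGaloisGroup F)) {U : Subgroup (absoluteGaloisGroup F)}
  (φ : contOneCocycles (subgroupRep X U))

/-- **A cocycle of an unramified, `ℓ'`-adically separated representation kills the wild inertia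
elements of its domain**: F6 `apply_eq_zero_of_mem_absWildInertia` for `σ ∈ P_F ∩ U` without
assuming `I_F ≤ U` (same proof: `P_F` is pro-`ℓ`, so `ℓ^a • φ(σ) ∈ V` for an open `V ∌ φ(σ)` with
`N • X ⊆ V`, `ℓ ∤ N`; Bezout).  Serre, *Local Fields*, IV §2. [folklore] -/
theorem apply_eq_zero_of_mem_absWildInertia_of_mem (hU : IsOpen (U : Set (absoluteGaloisGroup F)))
    (hX : ∀ σ ∈ absInertia F, ∀ x : X, X.ρ σ x = x)
    (hV : ∀ x : X, x ≠ 0 → ∃ (V : AddSubgroup X) (N : ℕ), IsOpen (V : Set X) ∧ x ∉ V ∧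
      ¬ ringChar 𝓀[F] ∣ N ∧ ∀ y : X, N • y ∈ V)
    {ϖ : 𝒪[F]} (hϖ : Irreducible ϖ) {σ : absoluteGaloisGroup F} (hσ : σ ∈ absWildInertia F ϖ)
    (hσU : σ ∈ U) : φ.1 ⟨σ, hσU⟩ = 0 := by
  have hσI : σ ∈ absInertia F := absWildInertia_le_absInertia F ϖ hσ
  by_contra hne
  obtain ⟨V, N, hVo, hxV, hN, hNV⟩ := hV _ hne
  set W : Set (absoluteGaloisGroup F) := Subtype.val '' {u : U | φ.1 u ∈ (V : Set X)} with hW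
  have hWo : IsOpen W := hU.isOpenMap_subtype_val _ (hVo.preimage φ.1.continuous)
  have h1W : (1 : absoluteGaloisGroup F) ∈ W :=
    ⟨1, by simp only [Set.mem_setOf_eq, contOneCocycles.apply_one, SetLike.mem_coe, zero_mem], rfl⟩
  obtain ⟨L, hLfd, hLW⟩ :=
    (krullTopology_mem_nhds_one_iff F (AlgebraicClosure F) W).mp (hWo.mem_nhds h1W)
  haveI := hLfd
  obtain ⟨a, ha⟩ := absWildInertia_isProP_holds F hϖ hσ L.fixingSubgroup
    (IntermediateField.fixingSubgroup_isOpen L)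
  obtain ⟨u, hu, hu'⟩ := hLW ha
  have hueq : u = (⟨σ, hσU⟩ : U) ^ (ringChar 𝓀[F] ^ a) :=
    Subtype.ext (by rw [hu', Subgroup.coe_pow])
  have hmem : (ringChar 𝓀[F] ^ a) • φ.1 ⟨σ, hσU⟩ ∈ V := by
    have h : φ.1 u ∈ (V : Set X) := hu
    rwa [hueq, apply_pow_eq_nsmul X φ _ (hX σ hσI)] at h
  have hcop : Nat.Coprime (ringChar 𝓀[F] ^ a) N :=
    Nat.Coprime.pow_left a ((Nat.Prime.coprime_iff_not_dvd (ringChar_residueField_prime (F := F))).mpr hN)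
  set x : X := φ.1 ⟨σ, hσU⟩ with hx
  have hbez : x = (Nat.gcdA (ringChar 𝓀[F] ^ a) N) • (((ringChar 𝓀[F] ^ a : ℕ) : ℤ) • x) +
      (Nat.gcdB (ringChar 𝓀[F] ^ a) N) • (((N : ℕ) : ℤ) • x) := by
    rw [smul_smul, smul_smul, ← add_smul, mul_comm (Nat.gcdA _ _), mul_comm (Nat.gcdB _ _),
      ← Nat.gcd_eq_gcd_ab, hcop.gcd_eq_one, Nat.cast_one, one_smul]
  apply hxV
  rw [hbez]
  refine V.add_mem (V.zsmul_mem ?_ _) (V.zsmul_mem ?_ _)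
  · rw [natCast_zsmul]; exact hmem
  · rw [natCast_zsmul]; exact hNV x

/-- **A cocycle of an unramified representation vanishes on the inertia elements of its domain when
a Frobenius power `τ ∈ U` has `ρ(τ) − q^m` injective** (F6 `apply_eq_zero_of_mem_absInertia` for
`σ ∈ I_F ∩ U`): `τ σ τ⁻¹ = w · σ^{q^m}` with `w ∈ P_F ∩ U`, so `τ · φ(σ) = q^m • φ(σ)`.
[cite: Rubin2011, Prop. 1.4.13 (2) (p. 9) and Exercise 1.9.2 (p. 14)] -/
theorem apply_eq_zero_of_mem_absInertia_of_mem (hU : IsOpen (U : Set (absoluteGaloisGroup F)))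
    (hX : ∀ σ ∈ absInertia F, ∀ x : X, X.ρ σ x = x)
    (hV : ∀ x : X, x ≠ 0 → ∃ (V : AddSubgroup X) (N : ℕ), IsOpen (V : Set X) ∧ x ∉ V ∧
      ¬ ringChar 𝓀[F] ∣ N ∧ ∀ y : X, N • y ∈ V)
    {τ : absoluteGaloisGroup F} (hτU : τ ∈ U) {m : ℕ} (hτ : IsFrobPow τ m)
    (hinj : Function.Injective fun x : X => X.ρ τ x - ((residueFieldCard F : R) ^ m) • x)
    {σ : absoluteGaloisGroup F} (hσ : σ ∈ absInertia F) (hσU : σ ∈ U) : φ.1 ⟨σ, hσU⟩ = 0 := by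
  obtain ⟨ϖ, hϖ⟩ := IsDiscreteValuationRing.exists_irreducible 𝒪[F]
  have hw := conj_mul_pow_inv_mem_absWildInertia hϖ.ne_zero hτ hσ
  have hwI : τ * σ * τ⁻¹ * (σ ^ residueFieldCard F ^ m)⁻¹ ∈ absInertia F :=
    absWildInertia_le_absInertia F ϖ hw
  have hwU : τ * σ * τ⁻¹ * (σ ^ residueFieldCard F ^ m)⁻¹ ∈ U :=
    U.mul_mem (U.mul_mem (U.mul_mem hτU hσU) (U.inv_mem hτU)) (U.inv_mem (U.pow_mem hσU _))
  have hφw : φ.1 ⟨_, hwU⟩ = 0 :=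
    apply_eq_zero_of_mem_absWildInertia_of_mem X φ hU hX hV hϖ hw hwU
  set t : U := ⟨τ, hτU⟩ with ht
  set s : U := ⟨σ, hσU⟩ with hs
  have hconj : t * s * t⁻¹ = ⟨_, hwU⟩ * s ^ (residueFieldCard F ^ m) :=
    Subtype.ext (by simp [ht, hs, mul_assoc])
  have hsx : ∀ x : X, X.ρ (s : absoluteGaloisGroup F) x = x := hX σ hσ
  have hwx : ∀ x : X, X.ρ ((⟨_, hwU⟩ : U) : absoluteGaloisGroup F) x = x := hX _ hwI
  have h1 : φ.1 (t * s * t⁻¹) = X.ρ τ (φ.1 s) := apply_conj_eq X φ t s hsx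
  have h2 : φ.1 (t * s * t⁻¹) = ((residueFieldCard F : R) ^ m) • φ.1 s := by
    rw [hconj, apply_mul_eq_add X φ _ _ hwx, hφw, zero_add, apply_pow_eq_nsmul X φ s hsx,
      ← Nat.cast_smul_eq_nsmul R, Nat.cast_pow]
  have hzero : X.ρ τ (φ.1 s) - ((residueFieldCard F : R) ^ m) • φ.1 s = 0 := by
    rw [← h1, h2, sub_self]
  have h0 : (fun x : X => X.ρ τ x - ((residueFieldCard F : R) ^ m) • x) (φ.1 s) =
      (fun x : X => X.ρ τ x - ((residueFieldCard F : R) ^ m) • x) 0 := by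
    simp only [map_zero, smul_zero, sub_zero]
    exact hzero
  exact hinj h0

end Local

/-! ### §2 Over a number field: every inertia group above `v`, intersected with `U` -/

section Global

variable {K : Type u} [Field K] [NumberField K]
variable {R : Type v} [Ring R] [TopologicalSpace R]
variable (X : TopRep.{u} R (absoluteGaloisGroup K)) {U : Subgroup (absoluteGaloisGroup K)}
  {v : HeightOneSpectrum (𝓞 K)}

/-- **THE `𝔓₀`-CASE, ramified level.**  A cocycle on an open `U` with values in `X` (unramified at
`v`, `v`-adically separated, `ρ(Fr)^m − q_v^m` injective for the Frobenii at the primes above `v`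
and their powers in `U`) vanishes at every `σ ∈ I_{𝔓₀} ∩ U`, `𝔓₀ = adicCompletionPrime K v`
(F6 `apply_eq_zero_of_mem_inertia_adicCompletionPrime` without `I ≤ U`). [folklore] -/
theorem apply_eq_zero_of_mem_inertia_adicCompletionPrime_of_mem
    (hU : IsOpen (U : Set (absoluteGaloisGroup K)))
    (hX : ∀ 𝔓 ∈ v.primesAbove, ∀ σ ∈ 𝔓.inertia (absoluteGaloisGroup K), ∀ x : X, X.ρ σ x = x)
    (hV : ∀ x : X, x ≠ 0 → ∃ (V : AddSubgroup X) (N : ℕ), IsOpen (V : Set X) ∧ x ∉ V ∧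
      (N : 𝓞 K) ∉ v.asIdeal ∧ ∀ y : X, N • y ∈ V)
    (hFrob : ∀ 𝔓 ∈ v.primesAbove, ∀ σ : absoluteGaloisGroup K, IsArithFrobAt (𝓞 K) σ 𝔓 →
      ∀ m : ℕ, 0 < m → σ ^ m ∈ U →
        Function.Injective fun x : X => X.ρ (σ ^ m) x - ((v.residueCard : R) ^ m) • x)
    (φ : contOneCocycles (subgroupRep X U))
    {σ : absoluteGaloisGroup K}
    (hσ : σ ∈ (adicCompletionPrime K v).inertia (absoluteGaloisGroup K)) (hσU : σ ∈ U) :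
    φ.1 ⟨σ, hσU⟩ = 0 := by
  classical
  set L := v.adicCompletion K with hL
  set res := absGaloisRestrict K L with hres_def
  have h𝔓₀ := adicCompletionPrime_mem_primesAbove K v
  set U' : Subgroup (absoluteGaloisGroup L) := U.comap res.toMonoidHom with hU'
  have hIres : ∀ t ∈ absInertia L, res t ∈ (adicCompletionPrime K v).inertia (absoluteGaloisGroup K) :=
    fun t ht => by
      rw [inertia_adicCompletionPrime_eq_map_absInertia]
      exact Subgroup.mem_map_of_mem _ ht
  have hU'o : IsOpen (U' : Set (absoluteGaloisGroup L)) := by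
    rw [hU', Subgroup.coe_comap]
    exact hU.preimage res.continuous_toFun
  let X' : TopRep.{u} R (absoluteGaloisGroup L) := TopRep.res (res : absoluteGaloisGroup L →* _) X
  let θ : U' →ₜ* U :=
    { toFun := fun u => ⟨res u, u.2⟩
      map_one' := Subtype.ext (by simp)
      map_mul' := fun a b => Subtype.ext (by simp)
      continuous_toFun := continuous_codRestrict_absGaloisRestrict L }
  let ψ : contOneCocycles (subgroupRep X' U') :=
    contOneCocycles.pullback θ (X := subgroupRep X U) (Y := subgroupRep X' U')
      (TopRep.ofHom ⟨ContinuousLinearMap.id R X, fun _ => rfl⟩) φ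
  have hψ : ∀ u : U', ψ.1 u = φ.1 ⟨res u, u.2⟩ := fun u => rfl
  have hX' : ∀ t ∈ absInertia L, ∀ x : X', X'.ρ t x = x := fun t ht x =>
    hX _ h𝔓₀ _ (hIres t ht) x
  have hV' : ∀ x : X', x ≠ 0 → ∃ (V : AddSubgroup X') (N : ℕ), IsOpen (V : Set X') ∧ x ∉ V ∧
      ¬ ringChar 𝓀[L] ∣ N ∧ ∀ y : X', N • y ∈ V := fun x hx => by
    obtain ⟨V, N, hVo, hxV, hN, hNV⟩ := hV x hx
    exact ⟨V, N, hVo, hxV, not_ringChar_residueField_adicCompletion_dvd K v hN, hNV⟩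
  obtain ⟨φ₀, hφ₀⟩ := exists_isAbsArithFrob_holds L
  have hφ₀1 : IsFrobPow φ₀ 1 := IsAbsArithFrob.isFrobPow_holds hφ₀
  have hres0 : IsArithFrobAt (𝓞 K) (res φ₀) (adicCompletionPrime K v) :=
    (isArithFrobAt_absGaloisRestrict_adicCompletionPrime_iff K v
      (by rw [Literature.NumberTheory.Automorphic.residueFieldCard_adicCompletion_eq K v,
        HeightOneSpectrum.residueCard_eq_card_quotient]) φ₀).2 hφ₀
  haveI : CompactSpace (absoluteGaloisGroup K) := absoluteGaloisGroup_compactSpace K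
  haveI : U.FiniteIndex := finiteIndex_of_isOpen_of_compactSpace U hU
  obtain ⟨n, hn0, -, hnU⟩ :=
    U.exists_pow_mem_of_index_ne_zero Subgroup.FiniteIndex.index_ne_zero (res φ₀)
  have hτU' : φ₀ ^ n ∈ U' := by
    rw [hU', Subgroup.mem_comap]
    change res (φ₀ ^ n) ∈ U
    rw [map_pow]
    exact hnU
  have hτ : IsFrobPow (φ₀ ^ n) (n : ℕ) := isFrobPow_pow_natCast hφ₀1 n
  have hq : residueFieldCard L = v.residueCard :=
    Literature.NumberTheory.Automorphic.residueFieldCard_adicCompletion_eq K v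
  have hinj' : Function.Injective fun x : X' => X'.ρ (φ₀ ^ n) x - ((residueFieldCard L : R) ^ n) • x := by
    have h := hFrob _ h𝔓₀ (res φ₀) hres0 n hn0 hnU
    have heq : (fun x : X' => X'.ρ (φ₀ ^ n) x - ((residueFieldCard L : R) ^ n) • x) =
        fun x : X => X.ρ (res φ₀ ^ n) x - ((v.residueCard : R) ^ n) • x := by
      funext x
      rw [hq, ← map_pow]
      rfl
    rw [heq]
    exact h
  -- `σ = res t` with `t ∈ I_L`; `t ∈ U'` since `res t = σ ∈ U`
  have hσ' := hσ
  rw [inertia_adicCompletionPrime_eq_map_absInertia] at hσ'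
  obtain ⟨t, ht, rfl⟩ := Subgroup.mem_map.mp hσ'
  have htU' : t ∈ U' := by rw [hU', Subgroup.mem_comap]; exact hσU
  have h := apply_eq_zero_of_mem_absInertia_of_mem X' ψ hU'o hX' hV' hτU' hτ hinj' ht htU'
  rw [hψ] at h
  exact h

/-- **THEOREM (cocycles of an unramified representation vanish on inertia, ramified levels).**
For `U ⊴ Γ_K` open (NOT assumed unramified at `v`), `X` unramified at `v`, `v`-adically separated,
with `ρ(Fr)^m − q_v^m` injective for the arithmetic Frobenii at the primes above `v` and the `m ≥ 1`
with `Fr^m ∈ U`: every continuous crossed homomorphism `φ : U → X` vanishes on `I_𝔓 ∩ U` for every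
`𝔓 ∣ v` (at `𝔓₀` by `apply_eq_zero_of_mem_inertia_adicCompletionPrime_of_mem`, at `𝔓 = δ⁻¹ • 𝔓₀` for
the conjugated cocycle `u ↦ δ · φ(δ⁻¹ u δ)`).  For an Euler system: the classes
`c_{F(rq)} ∈ H¹(F(rq), T)` are unramified at the primes above `q` although `F(rq)/K` ramifies there
— Perrin-Riou's hypothesis of Prop. 3.1.6. [cite: PerrinRiou1998AIF, Prop. 3.1.6]
[cite: Rubin2011, Prop. 1.4.13 (2) (p. 9)] -/
theorem apply_eq_zero_of_mem_inertia_of_mem [U.Normal] (hU : IsOpen (U : Set (absoluteGaloisGroup K)))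
    (hX : ∀ 𝔓 ∈ v.primesAbove, ∀ σ ∈ 𝔓.inertia (absoluteGaloisGroup K), ∀ x : X, X.ρ σ x = x)
    (hV : ∀ x : X, x ≠ 0 → ∃ (V : AddSubgroup X) (N : ℕ), IsOpen (V : Set X) ∧ x ∉ V ∧
      (N : 𝓞 K) ∉ v.asIdeal ∧ ∀ y : X, N • y ∈ V)
    (hFrob : ∀ 𝔓 ∈ v.primesAbove, ∀ σ : absoluteGaloisGroup K, IsArithFrobAt (𝓞 K) σ 𝔓 →
      ∀ m : ℕ, 0 < m → σ ^ m ∈ U →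
        Function.Injective fun x : X => X.ρ (σ ^ m) x - ((v.residueCard : R) ^ m) • x)
    (φ : contOneCocycles (subgroupRep X U))
    {𝔓 : Ideal (absIntegers (𝓞 K) K)} (h𝔓 : 𝔓 ∈ v.primesAbove) {σ : absoluteGaloisGroup K}
    (hσ : σ ∈ 𝔓.inertia (absoluteGaloisGroup K)) (hσU : σ ∈ U) : φ.1 ⟨σ, hσU⟩ = 0 := by
  have h𝔓₀ := adicCompletionPrime_mem_primesAbove K v
  obtain ⟨δ, hδ⟩ := HeightOneSpectrum.exists_smul_eq_of_mem_primesAbove_holds h𝔓 h𝔓₀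
  have hσ' : δ * σ * δ⁻¹ ∈ (adicCompletionPrime K v).inertia (absoluteGaloisGroup K) := by
    have h := conj_mem_inertia_smul hσ δ
    rwa [hδ] at h
  have hσ'U : δ * σ * δ⁻¹ ∈ U := ‹U.Normal›.conj_mem σ hσU δ
  have h := apply_eq_zero_of_mem_inertia_adicCompletionPrime_of_mem X hU hX hV hFrob
    (contOneCocycles.pullback (subgroupConj U δ) (conjRepHom X U δ) φ) hσ' hσ'U
  rw [conj_pullback_apply] at h
  have hconj : subgroupConj U δ ⟨δ * σ * δ⁻¹, hσ'U⟩ = ⟨σ, hσU⟩ :=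
    Subtype.ext (by simp only [subgroupConj_apply_coe]; group)
  rw [hconj] at h
  have h' := congrArg (X.ρ δ⁻¹) h
  rwa [ρ_inv_apply_ρ_apply, map_zero] at h'

end Global

/-! ### §3 For `T_p E` at a good place `v ∤ p` -/

section Tate

variable {K : Type u} [Field K] [NumberField K] (W : WeierstrassCurve K) [W.IsElliptic]
  (p : ℕ) [Fact p.Prime]
variable (hT : Continuous fun x : absoluteGaloisGroup K × W.tateModule p => W.galoisRepTate p x.1 x.2)

/-- **Every class of `H¹(U, T_p E)` vanishes on `I_𝔓 ∩ U` at a good place `v ∤ p`, for ANY open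
normal `U`** (also ramified at `v`, e.g. `U = Gal(K̄/K(rq))`, `𝔓 ∣ q`): F8
`apply_eq_zero_of_mem_inertia_tate` without `I ≤ U`, by `apply_eq_zero_of_mem_inertia_of_mem` with
`hX` = `isUnramifiedAt_tateGaloisRep`, `hV` = F8a `exists_addSubgroup_tateModule`, `hFrob` = F8a
`injective_galoisRepTate_pow_sub`.  (Rubin, PCMS 18, §3.1 p. 30: `Hom(I_{ℚ_ℓ}, T_p E)^{Frob} = 0`;
Perrin-Riou Prop. 3.1.6's unramifiedness hypothesis, discharged for `T_p E`.)  The three instance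
arguments are the tree's `W.module_free_tateModule_holds p`, `W.module_finite_tateModule_holds p`,
`TateModule.continuousSMul_padicInt`. [cite: Rubin2011, §3.1 (p. 30) and Prop. 1.4.13 (2) (p. 9)]
[cite: PerrinRiou1998AIF, Prop. 3.1.6] -/
theorem apply_eq_zero_of_mem_inertia_of_mem_tate [ContinuousSMul ℤ_[p] (W.tateModule p)]
    {U : Subgroup (absoluteGaloisGroup K)} [U.Normal] (hU : IsOpen (U : Set (absoluteGaloisGroup K)))
    {v : HeightOneSpectrum (𝓞 K)} (hpv : ((p : ℕ) : 𝓞 K) ∉ v.asIdeal) (hv : W.HasGoodReductionAt v)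
    (φ : contOneCocycles (subgroupRep (W.tateGaloisRep p hT).toTopRep U))
    {𝔓 : Ideal (absIntegers (𝓞 K) K)} (h𝔓 : 𝔓 ∈ v.primesAbove) {σ : absoluteGaloisGroup K}
    (hσ : σ ∈ 𝔓.inertia (absoluteGaloisGroup K)) (hσU : σ ∈ U) : φ.1 ⟨σ, hσU⟩ = 0 := by
  refine apply_eq_zero_of_mem_inertia_of_mem (W.tateGaloisRep p hT).toTopRep hU ?_ ?_ ?_ φ h𝔓 hσ hσU
  · intro 𝔓' h𝔓' τ hτ x
    have h := W.isUnramifiedAt_tateGaloisRep p hT hv hpv 𝔓' h𝔓' τ hτ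
    exact LinearMap.congr_fun h x
  · exact fun x hx => exists_addSubgroup_tateModule W p hpv x hx
  · intro 𝔓' h𝔓' τ hτ m hm _
    exact injective_galoisRepTate_pow_sub W p hpv hv h𝔓' hτ hm

end Tate

end Inertia

end Derivative

end Summit.BirchSwinnertonDyer.Rank1Residual.GaloisImage

end
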